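import Summits.BirchSwinnertonDyer.BirchSwinnertonDyer.Theorems.CongruentShaFreeCutTwoAdicBDPExistsValueUpTo
import Summits.BirchSwinnertonDyer.BirchSwinnertonDyer.Theorems.CongruentShaFreeCutKatoZetaRoadPinnedH2
import Literature.NumberTheory.EllipticCurves.CongruentNumberCurveMinimalAtTwo
import Literature.NumberTheory.EllipticCurves.ModularCurveManinConstantProofs
import HarnessLib

set_option linter.dupNamespace false -- `Summit.BirchSwinnertonDyer.BirchSwinnertonDyer.Theorems.…` (summit = sub)
set_option autoImplicit false

/-! # Route `CongruentShaFreeCut` (rung S2) — the ONE object shared by the two roads to crux B, typed: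
(ERL♯) «Kato ↔ BDP explicit reciprocity at the trivial character, up to a non-zero constant», and the
census `PRFormulaAtTwoH2 ⟸ (LB-exist∧bdp♯)∃ ∧ (ERL♯)` with the (ι, P)-commensurability PROVED

Cell `bsd-cn100`, prover seat `bsd-cn100-s2-c3` (g9); plan g15 ruling 2026-08-27T00:41:17Z (1) («(ERL♯) over
the EXISTING frame `IsBDPLFunctionUpTo` as ONE @[conjecture] def + census … the commensurability of the
statement's (ι, P) with the frame's reading PROVED from tree theorems, never assumed») executing the
decomposition of seat g8's MEMO-PR-at-2 §7 (adopted as route text): Perrin-Riou's formula at the additive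
prime `2` (`stub_prFormulaAtTwo : PRFormulaAtTwoH2`, the research stub of the registered kato-zeta line on
stmt-BirchSwinnertonDyer-19080) ⟸ (A1)+(A2) = the ♯-BDP element WITH its value at 𝟙
(`TwoAdicBDPElementExistsWithValueUpTo`, the registered EV♯∃ stub of stmt-19079, p478969) ∧ (A3) = a
RECIPROCITY LAW linking Kato's zeta class to the ♯-BDP value. Supports, does not close, stmt-19080.
THEOREMS + ONE `@[conjecture] def` (OPEN, nothing asserted); no named fact, no `sorry`.

* §1 `TwoAdicKatoBDPReciprocityUpTo` — (ERL♯): for the frame data of EV♯∃ (square-free `n`, imaginary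
  quadratic Heegner field `K` of level `N = N(E_n)` with `2 = v v̄`, `Dt`, `v ∋ 2`, anticyclotomic `κ`
  with topological generator `γ`) and `L(E_n, 1) = 0`: for EVERY admissible ♯-frame
  `(ι', Ω_K, Ω_p, C, 𝓛)` (`IsBDPLFunctionUpTo C ι' v κ γ Dt.f Ω_K Ω_p 𝓛`) and EVERY pinned Kato descent
  datum `(D, pin)` of `(E_n, 2)` satisfying Main Conjecture 12.10 up to powers of `2`, there are
  `t ∈ ℚ₂` and `c ∈ ℂ₂ˣ` with `HasLocPKummerLog (E_n) 2 pin.katoClass t` (the Kummer logarithm of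
  `loc₂` of Kato's class is `t`) and `𝓛(𝟙) = c · t`. NO Heegner point occurs. In print this link exists
  ONLY as the corollary «Perrin-Riou's formula ∘ (BDP's formula)⁻¹» where both are known (good
  `p = v v̄ ∤ N`: BDP 2013 Thm. 5.13 / Castella–Hsieh 2018; BDV 2022 Thm. A, BSTW 2024 Thm. 1.13) — NOT at
  `(E_n, 2)`; it is the cell's (A3). The ∀-frame form is the one closable independently of the
  construction (plan g15 RULING-4's reason for (LB-wan♯), verbatim).
* §3 `reciprocity_of_prFormula_of_valueAtOne` — CALIBRATION the other way: (ERL♯) ⟸ `PRFormulaAtTwoH2` ∧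
  (LB-bdp♯) `TwoAdicBDPValueAtOneUpTo` (landed def p450060) ∧ existence of Heegner points (refereed fact) — so
  (ERL♯) is exactly «PR minus BDP», never stronger.
* §2 `prFormulaAtTwoH2_of_bdpExistsValueUpTo_of_reciprocity` — THE CENSUS: `PRFormulaAtTwoH2 ⟸ EV♯∃ ∧
  (ERL♯)`, NOTHING ELSE (no RI fragment is needed). Commensurability, PROVED: PR's embedding
  `ι : K → ℚ₂` and Heegner point `P` (`IsHeegnerPoint N E_n K P`, i.e. `ι_K(P) = heegnerPointComplex Dt H`
  for SOME complex embedding `ι_K`) are moved to EV's reading through THE infinite place `w₀` by the Galois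
  conjugate `P' = τ P` (`τ ∈ Gal(K/ℚ)` with `w₀ ∘ τ = ι_K`, as in p478969) and the embedding `e = ι ∘ τ⁻¹`
  (so that `log_ω^{e}(P') = log_ω^{ι}(P)`, `Affine.Point.map_map`), `v := inducedPlace e`
  (CGLS §2), `(κ, γ)` from `X11b.exists_anticyclotomic_generator_degreeOnePrime`; then EV♯∃ gives a frame
  with `𝓛(𝟙) = u·c_{Dt}⁻²·(1 − a₂/2 + [2 ∤ N]/2)²·log_ω(P)²`, (ERL♯) gives `𝓛(𝟙) = c·t` with
  `HasLocPKummerLog … t`, uniqueness of the value (`UnrSeries.HasValueAt.unique`) and `a₂(E_n) = 0`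
  (`lFunction_congruentNumberCurve_apply_eq_zero_of_dvd_two_mul`: the Euler-type factor is `1` or `3/2`)
  give `t = c_P · log_ω(P)²` with `c_P ∈ ℚ₂ˣ` (the torsion case `log_ω P = 0` gives `t = 0`, any `c_P`).

HONEST FRAMING: ONE named open statement + a CONDITIONAL reduction; nothing here proves (ERL♯), EV♯∃,
`PRFormulaAtTwoH2`, crux A, crux B, the leaf `rankOne_twoConverse_congruentNumber`, the congruent number
problem or any case of BSD. (ERL♯) is research content: modulo EV♯∃ at the EV frame it is EQUIVALENT to
`PRFormulaAtTwoH2` restricted to that frame (this file proves one direction for all frames at once).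
PARTITION: none — RANK axis.

[cite: AlpogeBhargavaShnidman2022, App. A Thm. 10.8 (a) (p. 33) and §2 after Thm. 2.10 (shape of PR's formula; the gap)]
[cite: BertoliniDarmonPrasanna2013, Thm. 5.13 (shape of the value at the trivial character)]
[cite: BertoliniDarmonVenerucci2022, Thm. A (PR's conjecture at semistable odd p)]
[cite: CastellaGrossiLeeSkinner2022, §2 (the place induced by ι_p)]
-/

noncomputable section

open scoped Classical

namespace Summit.BirchSwinnertonDyer.BirchSwinnertonDyer.Theorems.CongruentShaFreeCutKatoBDPReciprocityUpTo

open PowerSeries WeierstrassCurve NumberField IsDedekindDomain Field Literature.NumberTheory.EllipticCurves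
  Literature.NumberTheory.EllipticCurves.ModularForms Literature.NumberTheory.QuadraticFields
  Literature.NumberTheory.EllipticCurves.Castella2018 Literature.NumberTheory.EllipticCurves.Kato2004
open Literature.NumberTheory.GaloisRepresentations Literature.NumberTheory.GaloisCohomology
open Summit.BirchSwinnertonDyer.BirchSwinnertonDyer.Theses.CongruentShaFreeCut
open Summit.BirchSwinnertonDyer.BirchSwinnertonDyer.Theorems.CongruentShaFreeCutTwoAdicBDPExistsValueUpTo
  (TwoAdicBDPElementExistsWithValueUpTo)
open Summit.BirchSwinnertonDyer.Rank1Residual.Additive (KatoDescentDatum)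
open Summit.BirchSwinnertonDyer.BirchSwinnertonDyer.Theorems.CongruentShaFreeCutKatoDescentDatumOfH2
open Summit.BirchSwinnertonDyer.BirchSwinnertonDyer.Theorems.CongruentShaFreeCutKatoZetaRoadPinnedH2
  (PRFormulaAtTwoH2)

/-! ## §1 (ERL♯) — the Kato ↔ BDP reciprocity at 𝟙, up to a non-zero constant (OPEN; named, nothing asserted) -/

/-- (ERL♯) — **the `2`-adic Kato ↔ BDP EXPLICIT RECIPROCITY AT THE TRIVIAL CHARACTER, UP TO A NON-ZERO
CONSTANT**, for the newform `Dt.f` of `E_n` (`n` square-free) over an imaginary quadratic Heegner field `K`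
of level `N = N(E_n)` with `2 = v v̄` split (Heegner for `2`) and `L(E_n^{(d_K)}, 1) ≠ 0` — the Heegner fields
of `PRFormulaAtTwoH2` ([ABS] §10.1.3) —, an anticyclotomic `κ` with topological generator `γ`, and
`L(E_n, 1) = 0`: for EVERY embedding datum `ι' : ℚ̄₂ ≃ ℂ` inducing `v`, EVERY admissible ♯-frame
`(Ω_K ≠ 0, Ω_p ∈ R₀ˣ, C ≠ 0, 𝓛 ∈ R₀⟦T⟧)` with `IsBDPLFunctionUpTo C ι' v κ γ Dt.f Ω_K Ω_p 𝓛`, and EVERY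
PINNED Kato descent datum `(D, pin)` of `(E_n, 2)` satisfying Kato's Main Conjecture 12.10 up to powers of
`2`, there are `t ∈ ℚ₂` and `c ∈ ℂ₂`, `c ≠ 0`, such that the localisation at `2` of the pinned Kato class is
a Kummer class of logarithm `t` (`HasLocPKummerLog (E_n) 2 pin.katoClass t`, Bloch–Kato / [ABS] §10.1.2
currency) and `𝓛(𝟙) = c · t` (`UnrSeries.HasValueAt 𝓛 0 (c · t)`). The cell's (A3) (MEMO-PR-at-2 §7):
NO Heegner point occurs; in print ONLY as the corollary PR ∘ BDP⁻¹ at good split `p ∤ N` (PR: BDV 2022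
Thm. A / BSTW 2024 Thm. 1.13; BDP: BDP 2013 Thm. 5.13) — OPEN at the additive prime `2`; nothing asserted.
Modulo EV♯∃ at its frame it is equivalent to `PRFormulaAtTwoH2` there (§2 proves «⟹» for all frames).
[cite: AlpogeBhargavaShnidman2022, App. A Thm. 10.8 (a) (p. 33) (shape; nothing asserted at p = 2)]
[cite: BertoliniDarmonPrasanna2013, Thm. 5.13 (shape)] [cite: BertoliniDarmonVenerucci2022, Thm. A (shape at semistable odd p)] -/
@[conjecture] def TwoAdicKatoBDPReciprocityUpTo : Prop :=
  ∀ ⦃n : ℕ⦄, Squarefree n →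
    ∀ [(congruentNumberCurve n).IsElliptic] [(congruentNumberCurve n).IsGloballyMinimal]
      [ContinuousSMul ℤ_[2] ((congruentNumberCurve n).tateModule 2)]
      (K : Type) [Field K] [NumberField K] (N : ℕ) [NeZero N]
      (Dt : ModularParametrizationData (congruentNumberCurve n) N)
      (v : HeightOneSpectrum (𝓞 K)) (κ : ZpExtension K 2) (γ : absoluteGaloisGroup K)
      [Fact (κ.IsTopGenerator γ)],
    (congruentNumberCurve n).conductorNorm ℤ = N → IsImaginaryQuadratic K →
    SatisfiesHeegnerHypothesis N K → SatisfiesHeegnerHypothesis 2 K →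
    ((congruentNumberCurve n).quadraticTwist (NumberField.discr K : ℚ)).entireLFunction 1 ≠ 0 →
    ((Ideal.span {(2 : ℤ)}).primesOver (𝓞 K)).ncard = 2 →
    ((2 : ℕ) : 𝓞 K) ∈ v.asIdeal → κ.IsAnticyclotomic →
    (congruentNumberCurve n).entireLFunction 1 = 0 →
    ∀ (ι' : PadicAlgCl 2 ≃+* ℂ),
      (∀ (w' : InfinitePlace K) (k : 𝓞 K), k ∈ v.asIdeal ↔ ‖ι'.symm (w'.embedding (k : K))‖ < 1) →
    ∀ (ΩK : ℂ) (Ωp : (unrIntegers 2)ˣ) (C : ℂ_[2]) (L : UnrSeries 2),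
      ΩK ≠ 0 → C ≠ 0 → IsBDPLFunctionUpTo C ι' v κ γ Dt.f ΩK ((Ωp : unrIntegers 2) : ℂ_[2]) L →
    ∀ (D : KatoDescentDatum 2) (pin : KatoDescentDatumPinH2 (congruentNumberCurve n) 2 D),
      (∃ a b : ℕ,
        Ideal.span {((2 : ℕ) : IwasawaAlgebra 2) ^ a} * Module.charIdeal (IwasawaAlgebra 2) D.H2 =
          Ideal.span {((2 : ℕ) : IwasawaAlgebra 2) ^ b} *
            Module.charIdeal (IwasawaAlgebra 2) (D.H ⧸ (IwasawaAlgebra 2) ∙ D.z)) →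
      ∃ (t : ℚ_[2]) (c : ℂ_[2]), c ≠ 0 ∧
        HasLocPKummerLog (congruentNumberCurve n) 2 pin.katoClass t ∧
        L.HasValueAt 0 (c * algebraMap ℚ_[2] ℂ_[2] t)

/-! ## §2 The census: `PRFormulaAtTwoH2 ⟸ EV♯∃ ∧ (ERL♯)` with the commensurability proved -/

/-- `log_ω` of the `ρ`-image of a point read along `ι` is `log_ω` of the point read along `ι ∘ ρ` (the
underlying `ℚ₂`-point is the same: `Affine.Point.map_map`). [folklore] -/
theorem padicLogOmega_map {n : ℕ} [(congruentNumberCurve n).IsElliptic]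
    [(congruentNumberCurve n).IsGloballyMinimal] {K : Type} [Field K] [NumberField K]
    (ι : K →+* ℚ_[2]) (ρ : K →+* K) (P : ((congruentNumberCurve n).baseChange K).toAffine.Point) :
    padicLogOmega (congruentNumberCurve n) 2 ι (WeierstrassCurve.Affine.Point.map ρ.toRatAlgHom P) =
      padicLogOmega (congruentNumberCurve n) 2 (ι.comp ρ) P := by
  unfold padicLogOmega padicPointOf
  rw [WeierstrassCurve.Affine.Point.map_map]
  rfl

/-- `log_ω` read along `ι ∘ σ` of the `σ⁻¹`-conjugate point is `log_ω` read along `ι` (the underlying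
`ℚ₂`-point is the same: `Affine.Point.map_map`). [folklore] -/
theorem padicLogOmega_comp_map_symm {n : ℕ} [(congruentNumberCurve n).IsElliptic]
    [(congruentNumberCurve n).IsGloballyMinimal] {K : Type} [Field K] [NumberField K]
    (ι : K →+* ℚ_[2]) (σ : K ≃ₐ[ℚ] K) (P : ((congruentNumberCurve n).baseChange K).toAffine.Point) :
    padicLogOmega (congruentNumberCurve n) 2 (ι.comp (σ : K →+* K))
        (WeierstrassCurve.Affine.Point.map ((σ.symm : K ≃ₐ[ℚ] K) : K →+* K).toRatAlgHom P) =
      padicLogOmega (congruentNumberCurve n) 2 ι P := by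
  unfold padicLogOmega padicPointOf
  rw [WeierstrassCurve.Affine.Point.map_map]
  have hcomp : (ι.comp (σ : K →+* K)).toRatAlgHom.comp ((σ.symm : K ≃ₐ[ℚ] K) : K →+* K).toRatAlgHom =
      ι.toRatAlgHom := by
    apply AlgHom.ext
    intro x
    change ι (σ (σ.symm x)) = ι x
    rw [AlgEquiv.apply_symm_apply]
  rw [hcomp]

/-- **THE CENSUS — Perrin-Riou's formula at `2` follows from the ♯-BDP element with its value (EV♯∃,
registered on stmt-19079) and the Kato ↔ BDP reciprocity (ERL♯), NOTHING ELSE.** For PR's data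
(`n`, Heegner field `K` for `N` and for `2`, `ι : K → ℚ₂`, Heegner point `P`, `L(E_n,1) = 0`, pinned datum
with MC): conjugate the Heegner reading to THE infinite place `w₀` (`P' = τP`, `e = ι ∘ τ⁻¹`,
`log_ω^{e} P' = log_ω^{ι} P`), take `v = inducedPlace e` and an anticyclotomic `(κ, γ)`; EV♯∃ gives an
admissible frame with `𝓛(𝟙) = u · c_{Dt}⁻² · (1 − a₂/2 + [2 ∤ N]/2)² · log_ω(P)²`, (ERL♯) gives
`𝓛(𝟙) = c · t` with `loc₂` of the Kato class a Kummer class of logarithm `t`; by uniqueness of the value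
and `a₂(E_n) = 0`, `t = c_P · log_ω(P)²` with `c_P = c⁻¹ u c_{Dt}⁻² (…)² ∈ ℚ₂ˣ` (it lies in `ℚ₂` because
`t` and `log_ω(P)² ≠ 0` do; if `log_ω P = 0` then `t = 0` and any `c_P` serves). CONDITIONAL; credits
nothing beyond the reduction. [cite: AlpogeBhargavaShnidman2022, App. A Thm. 10.8 (a) (p. 33) and §10.1.2–§10.1.3]
[cite: CastellaGrossiLeeSkinner2022, §2 (the place induced by ι_p)] -/
theorem prFormulaAtTwoH2_of_bdpExistsValueUpTo_of_reciprocity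
    (hEV : TwoAdicBDPElementExistsWithValueUpTo) (hERL : TwoAdicKatoBDPReciprocityUpTo) :
    PRFormulaAtTwoH2 := by
  intro n hsq _ _ _ K _ _ N _ hN hK hHN hH2 hLtw ι P hP hL1 D pin hMC
  -- (0) `2 = v v̄` splits in `K`
  have hsplit : ((Ideal.span {(2 : ℤ)}).primesOver (𝓞 K)).ncard = 2 := by
    simpa using hH2 2 Nat.prime_two (dvd_refl 2)
  -- (1) the Heegner reading of `P`, conjugated to THE infinite place `w₀`
  obtain ⟨Dt, H, ιK, hPι⟩ := hP
  obtain ⟨w₀⟩ := (inferInstance : Nonempty (InfinitePlace K))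
  haveI : IsGalois ℚ K := by
    haveI : Algebra.IsQuadraticExtension ℚ K := ⟨hK.1⟩
    infer_instance
  obtain ⟨σ, hσ⟩ := ComplexEmbedding.exists_comp_symm_eq_of_comp_eq (k := ℚ) w₀.embedding ιK
    (by ext x; simp)
  set τ : K →+* K := ((σ.symm : K ≃ₐ[ℚ] K) : K →+* K) with hτdef
  set P' := WeierstrassCurve.Affine.Point.map τ.toRatAlgHom P with hP'def
  have hP' : WeierstrassCurve.Affine.Point.map w₀.embedding.toRatAlgHom P' =
      heegnerPointComplex Dt H := by
    rw [hP'def, WeierstrassCurve.Affine.Point.map_map]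
    have hcomp : w₀.embedding.toRatAlgHom.comp τ.toRatAlgHom = ιK.toRatAlgHom := by
      apply AlgHom.ext
      intro x
      have := RingHom.congr_fun hσ x
      simpa [hτdef] using this
    rw [hcomp]
    exact hPι
  -- (2) the embedding `e = ι ∘ τ⁻¹`, its induced place `v ∋ 2`, an anticyclotomic `(κ, γ)`
  set e : K →+* ℚ_[2] := ι.comp (σ : K →+* K) with hedef
  have hlog : padicLogOmega (congruentNumberCurve n) 2 e P' = padicLogOmega (congruentNumberCurve n) 2 ι P :=
    padicLogOmega_comp_map_symm ι σ P
  set v := Summit.BirchSwinnertonDyer.Rank1Residual.X11b.inducedPlace e with hvdef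
  have hv : ∀ x : 𝓞 K, x ∈ v.asIdeal ↔ ‖e (x : K)‖ < 1 :=
    Summit.BirchSwinnertonDyer.Rank1Residual.X11b.mem_inducedPlace_iff e
  have hv2 : ((2 : ℕ) : 𝓞 K) ∈ v.asIdeal :=
    Summit.BirchSwinnertonDyer.Rank1Residual.X11b.natCast_mem_inducedPlace e
  obtain ⟨κ, γ, -, hκ, hγ, -, -, -⟩ :=
    Summit.BirchSwinnertonDyer.Rank1Residual.X11b.exists_anticyclotomic_generator_degreeOnePrime
      2 K hK hH2
  haveI : Fact (κ.IsTopGenerator γ) := ⟨hγ⟩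
  -- (3) EV♯∃ at `(Dt, H, w₀, e, v, κ, γ, P')`: ONE frame WITH its value at `𝟙`
  obtain ⟨ι', hι', ΩK, Ωp, Cst, L, hΩK, hC, hBDP, u, hu0, hu⟩ :=
    hEV hsq K N Dt H w₀ e v κ γ P' hN hK hHN hsplit hv2 hκ hP' hv
  -- (4) (ERL♯) at the same frame and the given pinned datum
  obtain ⟨t, c, hc0, hKum, ht⟩ :=
    hERL hsq K N Dt v κ γ hN hK hHN hH2 hLtw hsplit hv2 hκ hL1 ι' hι' ΩK Ωp Cst L hΩK hC hBDP D pin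
      hMC
  -- (5) compare the two values at `𝟙`
  have heq := ht.unique hu
  rw [hlog] at heq
  -- the Euler-type factor is non-zero: `a₂(E_n) = 0`
  have ha2 : (congruentNumberCurve n).LFunction 2 = 0 :=
    lFunction_congruentNumberCurve_apply_eq_zero_of_dvd_two_mul hsq Nat.prime_two (dvd_mul_right 2 n)
  set A : ℚ_[2] := ((Dt.c : ℚ_[2])⁻¹) ^ 2 *
      (1 - ((congruentNumberCurve n).LFunction 2 : ℚ_[2]) * (2 : ℚ_[2])⁻¹ +
        (if (2 : ℕ) ∣ N then 0 else (2 : ℚ_[2])⁻¹)) ^ 2 with hAdef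
  have hA0 : A ≠ 0 := by
    rw [hAdef, ha2]
    refine mul_ne_zero (pow_ne_zero _ (inv_ne_zero ?_)) (pow_ne_zero _ ?_)
    · exact_mod_cast Dt.maninConstant_ne_zero_holds
    · push_cast
      rw [zero_mul, sub_zero]
      split_ifs
      · norm_num
      · norm_num
  -- (6) the constant `c_P`
  by_cases hlog0 : padicLogOmega (congruentNumberCurve n) 2 ι P = 0
  · -- torsion-type case: `𝓛(𝟙) = 0`, so `t = 0`; any constant serves
    refine ⟨1, one_ne_zero, ?_⟩
    have ht0 : t = 0 := by
      have h1 : (c : ℂ_[2]) * algebraMap ℚ_[2] ℂ_[2] t = 0 := by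
        rw [heq, hlog0]; simp
      rcases mul_eq_zero.mp h1 with h | h
      · exact absurd h hc0
      · exact (map_eq_zero_iff _ (algebraMap ℚ_[2] ℂ_[2]).injective).mp h
    rw [hlog0]
    simpa [ht0] using hKum
  · refine ⟨t / padicLogOmega (congruentNumberCurve n) 2 ι P ^ 2, ?_, ?_⟩
    · -- `c_P ≠ 0`: `t ≠ 0` since `c · t = u · A · log² ≠ 0`
      have ht0 : t ≠ 0 := by
        intro h0
        rw [h0, map_zero, mul_zero] at heq
        have h1 : (u : ℂ_[2]) * algebraMap ℚ_[2] ℂ_[2] (A * padicLogOmega (congruentNumberCurve n) 2 ι P ^ 2)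
            = 0 := by rw [hAdef]; exact heq.symm
        rcases mul_eq_zero.mp h1 with h | h
        · exact hu0 h
        · rw [map_eq_zero_iff _ (algebraMap ℚ_[2] ℂ_[2]).injective] at h
          exact (mul_ne_zero hA0 (pow_ne_zero 2 hlog0)) h
      exact div_ne_zero ht0 (pow_ne_zero 2 hlog0)
    · rw [div_mul_cancel₀ t (pow_ne_zero 2 hlog0)]
      exact hKum

/-! ## §3 Calibration: (ERL♯) ⟸ `PRFormulaAtTwoH2` ∧ (LB-bdp♯) ∧ Heegner points — the new statement is
EXACTLY the residue of Perrin-Riou's formula after the BDP value formula, not more -/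

/-- **(ERL♯) is not stronger than «PR ∧ BDP»**: Perrin-Riou's formula `PRFormulaAtTwoH2` together with
the ∀-frame value formula (LB-bdp♯) `TwoAdicBDPValueAtOneUpTo` (landed def, p450060; its surplus over the
∃-form is the character supply, a tree theorem) and the existence of Heegner points (refereed fact,
Gross 1984) imply (ERL♯): at a frame for `(v, Dt)` read PR at the embedding `e ∘ τ` attached to the
DEGREE-ONE prime `v` (`X11b.embAt`, `τ ∈ Gal(K/ℚ)` conjugating the Heegner reading to THE infinite place)
and a Heegner point `P`, getting `t = c_P · log_ω(P)²`, and (LB-bdp♯) at the reading `(w₀, e, τP)`,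
getting `𝓛(𝟙) = u·A·log_ω(P)²` (`A = c_{Dt'}⁻²(1 − a₂/2 + [2∤N]/2)²`, the newform being unique,
`IsNewformOf.unique`); so `𝓛(𝟙) = (u·A·c_P⁻¹) · t`. With §2 this makes (ERL♯) ⟺ PR modulo the BDP side.
CONDITIONAL; credits nothing. [cite: AlpogeBhargavaShnidman2022, App. A Thm. 10.8 (a) (p. 33)]
[cite: Gross1984, §§3–4 (Heegner points)] -/
theorem reciprocity_of_prFormula_of_valueAtOne
    (hHP : ∀ (W : WeierstrassCurve ℚ) (K : Type) [Field K] [NumberField K], exists_isHeegnerPoint W K)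
    (hPR : PRFormulaAtTwoH2)
    (hV : Summit.BirchSwinnertonDyer.BirchSwinnertonDyer.Theorems.CongruentShaFreeCutTwoAdicBDPTripleUpTo.TwoAdicBDPValueAtOneUpTo) :
    TwoAdicKatoBDPReciprocityUpTo := by
  intro n hsq _ _ _ K _ _ N _ Dt v κ γ _ hN hK hHN hH2 hLtw hsplit hv2 hκ hL1 ι' hι' ΩK Ωp Cst L hΩK hC
    hBDP D pin hMC
  subst hN
  -- (1) the embedding at the degree-one prime `v ∋ 2`
  have hsplit' : Summit.BirchSwinnertonDyer.Rank1Residual.X11b.SplitsIn K 2 :=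
    hH2 2 Nat.prime_two (dvd_refl 2)
  obtain ⟨he1, hf1⟩ :=
    Summit.BirchSwinnertonDyer.Rank1Residual.X11b.degreeOne_of_splitsIn hK.1 hsplit' hv2
  set e : K →+* ℚ_[2] := Summit.BirchSwinnertonDyer.Rank1Residual.X11b.embAt K 2 v hv2 he1 hf1 with hedef
  have he : ∀ k : 𝓞 K, k ∈ v.asIdeal ↔ ‖e (k : K)‖ < 1 :=
    Summit.BirchSwinnertonDyer.Rank1Residual.X11b.mem_asIdeal_iff_norm_embAt_lt_one v hv2 he1 hf1
  -- (2) a Heegner point and its reading through THE infinite place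
  obtain ⟨P, Dt', H, ιK, hPι⟩ := hHP (congruentNumberCurve n) K hK hHN
  obtain ⟨w₀⟩ := (inferInstance : Nonempty (InfinitePlace K))
  haveI : IsGalois ℚ K := by
    haveI : Algebra.IsQuadraticExtension ℚ K := ⟨hK.1⟩
    infer_instance
  obtain ⟨σ, hσ⟩ := ComplexEmbedding.exists_comp_symm_eq_of_comp_eq (k := ℚ) w₀.embedding ιK
    (by ext x; simp)
  set τ : K →+* K := ((σ.symm : K ≃ₐ[ℚ] K) : K →+* K) with hτdef
  set P' := WeierstrassCurve.Affine.Point.map τ.toRatAlgHom P with hP'def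
  have hP' : WeierstrassCurve.Affine.Point.map w₀.embedding.toRatAlgHom P' =
      heegnerPointComplex Dt' H := by
    rw [hP'def, WeierstrassCurve.Affine.Point.map_map]
    have hcomp : w₀.embedding.toRatAlgHom.comp τ.toRatAlgHom = ιK.toRatAlgHom := by
      apply AlgHom.ext
      intro x
      have := RingHom.congr_fun hσ x
      simpa [hτdef] using this
    rw [hcomp]
    exact hPι
  -- (3) PR at `(e ∘ τ, P)`: `t := c_P · log_ω(P)²`
  obtain ⟨cP, hcP0, hKum⟩ := hPR hsq K ((congruentNumberCurve n).conductorNorm ℤ) rfl hK hHN hH2 hLtw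
    (e.comp τ) P ⟨Dt', H, ιK, hPι⟩ hL1 D pin hMC
  -- (4) (LB-bdp♯) at the reading `(w₀, e, P')` and the frame (for `Dt'.f = Dt.f`)
  have hff : Dt'.f = Dt.f := Dt'.isNewformOf.unique Dt.isNewformOf
  have hBDP' : IsBDPLFunctionUpTo Cst ι' v κ γ Dt'.f ΩK ((Ωp : unrIntegers 2) : ℂ_[2]) L := by
    rw [hff]; exact hBDP
  obtain ⟨u, hu0, hu⟩ := hV hsq ι' K _ Dt' H w₀ e v κ γ P' rfl hK hHN hsplit hv2 hι' hκ hP' he ΩK Ωp Cst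
    L hΩK hC hBDP'
  rw [hP'def, padicLogOmega_map] at hu
  -- (5) the constant
  set A : ℚ_[2] := ((Dt'.c : ℚ_[2])⁻¹) ^ 2 *
      (1 - ((congruentNumberCurve n).LFunction 2 : ℚ_[2]) * (2 : ℚ_[2])⁻¹ +
        (if (2 : ℕ) ∣ (congruentNumberCurve n).conductorNorm ℤ then 0 else (2 : ℚ_[2])⁻¹)) ^ 2
    with hAdef
  refine ⟨cP * padicLogOmega (congruentNumberCurve n) 2 (e.comp τ) P ^ 2,
    u * algebraMap ℚ_[2] ℂ_[2] (A * cP⁻¹), ?_, hKum, ?_⟩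
  · refine mul_ne_zero hu0 ?_
    rw [map_ne_zero_iff _ (algebraMap ℚ_[2] ℂ_[2]).injective]
    refine mul_ne_zero ?_ (inv_ne_zero hcP0)
    have ha2 : (congruentNumberCurve n).LFunction 2 = 0 :=
      lFunction_congruentNumberCurve_apply_eq_zero_of_dvd_two_mul hsq Nat.prime_two (dvd_mul_right 2 n)
    rw [hAdef, ha2]
    refine mul_ne_zero (pow_ne_zero _ (inv_ne_zero ?_)) (pow_ne_zero _ ?_)
    · exact_mod_cast Dt'.maninConstant_ne_zero_holds
    · push_cast
      rw [zero_mul, sub_zero]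
      split_ifs
      · norm_num
      · norm_num
  · have hrew : u * algebraMap ℚ_[2] ℂ_[2] (A * cP⁻¹) *
        algebraMap ℚ_[2] ℂ_[2] (cP * padicLogOmega (congruentNumberCurve n) 2 (e.comp τ) P ^ 2) =
        u * algebraMap ℚ_[2] ℂ_[2] (A * padicLogOmega (congruentNumberCurve n) 2 (e.comp τ) P ^ 2) := by
      rw [mul_assoc, ← map_mul]
      congr 2
      field_simp
    rw [hrew, hAdef]
    exact hu

end Summit.BirchSwinnertonDyer.BirchSwinnertonDyer.Theorems.CongruentShaFreeCutKatoBDPReciprocityUpTo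

end
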